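import Literature.Probability.LatticeModels.GlauberBoundaryGradientBoxStep
import Literature.Probability.LatticeModels.StrongMixingOfSMT
import HarnessLib

/-!
# [Mar99] Lemma 4.7: the Dirichlet form of `g = √(μ_B(f²))` from the boundary-gradient bound, PROVED

Topic `Literature/Probability/LatticeModels`; cell `ym-ir`, seat lit-3 (census rows B2/B4).  Theorems only
(D-0026).  [Mar99] F. Martinelli, LNM 1717 (1999), Lemma 4.7 p0191 L16–19 and its proof p0192 L25–33 (held text
`book:bertoin1999-lectures-probability-theory-statistics`): for the two-block geometry `V = A ∪ B` of Theorem 4.6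
and `g = (μ_B(f²))^{1/2}`,
`μ_V^τ(|∇_A g|²) ≤ μ_V^τ(|∇_A f|²) + k₁ μ_V^τ(|∇_O f|²) + η μ_V^τ(|∇_B f|²)`,
GIVEN the boundary-gradient bound (4.28) of Corollary 4.9 for the block `B` (hypothesis `hGB`; proved for fat
rectangles in `GlauberBoundaryGradientUniform`).  Proof as printed: for `x ∈ A ∩ B`, `∇_x g = 0`; for `x ∈ A` far
from `B` (`d(x,B) > r`), `|∇_x g|² ≤ μ_B(|∇_x f|²)` («we compute directly», p0192 L25–27; here the reverse triangle
inequality `sq_sqrt_sub_sqrt_le_of_forall_lt`); for the remaining `x` (the strip `O ⊇ A ∩ ∂_r^+B`, hypothesis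
`h1`) Corollary 4.9; then sum over `x` and integrate by the DLR equations.  The double sum
`Σ_{x∈O} Σ_{y∈B} e^{−m'|x−y|} μ(|∇_y f|²)` is split into `y ∈ O` (lattice sum `K₁`) and `y ∈ B ∖ O` at distance
`≥ w₀` from the strip (hypothesis `h2`; factor `e^{−m'w₀/2} K₂`), which is the printed `e^{−k₂√L}` when the
overlap has width `√L`.  RENDERING NOTE: the printed statement carries the `k₁`-term on the overlap
`R^{top} ∩ R^{bot}` only; since Corollary 4.9's constant `k` multiplies `μ(|∇_x f|²)` for `x` in the `r`-strip
ABOVE the overlap as well, the error strip `O` here is any set containing those sites (in Theorem 4.6: the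
overlap plus the `r`-strip), and the averaging over `n` uses the companion
`logSobolevIneq_of_twoBlock_family_strips`.  SIBLING-SETTING material; the Yang–Mills gap is not touched.
[cite: Martinelli1999, Lemma 4.7]
-/

open MeasureTheory ProbabilityTheory Finset Filter

noncomputable section

namespace Literature.Probability.LatticeModels

namespace Glauber

variable {d r : ℕ} (U : FRPotential d ℤˣ r) (β : ℝ)

set_option maxHeartbeats 4000000 in
/-- **[Mar99] Lemma 4.7** (from the boundary-gradient bound (4.28) of the block `B`): see the module docstring.
Constants: `k₁ = k (1 + K₁)`, `η = k K₂ e^{−m' w₀/2}` with the lattice sums `K₁ = (2/(1−e^{−m'/d}))^d`,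
`K₂ = (2/(1−e^{−m'/(2d)}))^d`. [cite: Martinelli1999, Lemma 4.7] -/
theorem integral_gradSq_sqrt_bavg_le (hd : 0 < d) {V A B O : Finset (Site d)} (hBV : B ⊆ V)
    (τ : Site d → ℤˣ) {k m' : ℝ} (hk : 0 ≤ k) (hm' : 0 < m')
    (hGB : ∀ (σ : Site d → ℤˣ) (x : Site d), x ∉ B → ∀ f : (Site d → ℤˣ) → ℝ, Measurable f →
      ∀ C : ℝ, (∀ σ, |f σ| ≤ C) →
        (Real.sqrt (∫ ω, f ω ^ 2 ∂(U.spec β B (spinFlip x σ))) - Real.sqrt (∫ ω, f ω ^ 2 ∂(U.spec β B σ))) ^ 2 ≤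
          k * (∫ ω, siteGrad x f ω ^ 2 ∂(U.spec β B σ) +
            ∑ y ∈ B, Real.exp (-(m' * (supDist x y : ℝ))) * ∫ ω, siteGrad y f ω ^ 2 ∂(U.spec β B σ)))
    (h1 : ∀ x ∈ A, x ∉ B → x ∉ O → ∀ z ∈ B, r < supDist x z)
    {w₀ : ℕ} (h2 : ∀ y ∈ B, y ∉ O → ∀ x ∈ A, x ∉ B → x ∈ O → w₀ ≤ supDist x y)
    {f : (Site d → ℤˣ) → ℝ} (hf : Measurable f) {C : ℝ} (hC : ∀ σ, |f σ| ≤ C) :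
    ∫ σ, gradSq A (fun ω => Real.sqrt (bavg (U.spec β) B (fun ω' => f ω' ^ 2) ω)) σ ∂(U.spec β V τ) ≤
      ∫ σ, gradSq A f σ ∂(U.spec β V τ) +
        (k * (1 + (2 * (1 - Real.exp (-(m' / d)))⁻¹) ^ d)) * ∫ σ, gradSq O f σ ∂(U.spec β V τ) +
        (k * (2 * (1 - Real.exp (-(m' / 2 / d)))⁻¹) ^ d * Real.exp (-(m' / 2 * w₀))) *
          ∫ σ, gradSq B f σ ∂(U.spec β V τ) := by
  classical
  have hγ := U.isSpecification_spec β
  set μ := U.spec β V τ with hμ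
  haveI : IsProbabilityMeasure μ := hγ.isProbability V τ
  have hC0 : 0 ≤ C := (abs_nonneg _).trans (hC τ)
  set K₁ : ℝ := (2 * (1 - Real.exp (-(m' / d)))⁻¹) ^ d with hK₁
  set K₂ : ℝ := (2 * (1 - Real.exp (-(m' / 2 / d)))⁻¹) ^ d with hK₂
  have hdpos : (0 : ℝ) < d := by exact_mod_cast hd
  have hK₁0 : 0 ≤ K₁ := by
    rw [hK₁]; refine pow_nonneg (mul_nonneg (by norm_num) (inv_nonneg.2 ?_)) _
    have : Real.exp (-(m' / d)) < 1 := Real.exp_lt_one_iff.2 (by rw [neg_lt_zero]; positivity)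
    linarith
  have hK₂0 : 0 ≤ K₂ := by
    rw [hK₂]; refine pow_nonneg (mul_nonneg (by norm_num) (inv_nonneg.2 ?_)) _
    have : Real.exp (-(m' / 2 / d)) < 1 := Real.exp_lt_one_iff.2 (by rw [neg_lt_zero]; positivity)
    linarith
  -- the function `g`
  set q : (Site d → ℤˣ) → ℝ := bavg (U.spec β) B (fun ω' => f ω' ^ 2) with hq
  set g : (Site d → ℤˣ) → ℝ := fun ω => Real.sqrt (q ω) with hg
  have hf2m : Measurable (fun ω => f ω ^ 2) := hf.pow_const 2
  have hf2b : ∀ ω, |f ω ^ 2| ≤ C ^ 2 := fun ω => by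
    rw [abs_pow]; exact pow_le_pow_left₀ (abs_nonneg _) (hC ω) 2
  have hqm : Measurable q := measurable_bavg hγ B hf2m
  have hgm : Measurable g := hqm.sqrt
  have hq0 : ∀ σ, 0 ≤ q σ := fun σ => integral_nonneg fun _ => sq_nonneg _
  have hqC : ∀ σ, q σ ≤ C ^ 2 := fun σ => (le_abs_self _).trans (abs_bavg_le hγ B hf2b σ)
  have hgb : ∀ σ, |g σ| ≤ C := fun σ => by
    show |Real.sqrt (q σ)| ≤ C
    rw [abs_of_nonneg (Real.sqrt_nonneg _), Real.sqrt_le_left hC0]; exact hqC σ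
  have hgdep : DependsOn g ((↑B : Set (Site d))ᶜ) := fun σ σ' h => by
    show Real.sqrt (q σ) = Real.sqrt (q σ')
    rw [show q σ = q σ' from dependsOn_bavg hγ B hf2m h]
  -- the weights and the Dirichlet pieces
  set e : Site d → Site d → ℝ := fun x y => Real.exp (-(m' * (supDist x y : ℝ))) with he
  have he0 : ∀ x y, 0 ≤ e x y := fun x y => Real.exp_nonneg _
  set D : Site d → ℝ := fun y => ∫ σ, siteGrad y f σ ^ 2 ∂μ with hD
  have hD0 : ∀ y, 0 ≤ D y := fun y => integral_nonneg fun _ => sq_nonneg _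
  have hiDf : ∀ (y : Site d) (ν : Measure (Site d → ℤˣ)) [IsFiniteMeasure ν],
      Integrable (fun σ => siteGrad y f σ ^ 2) ν := fun y ν _ =>
    Integrable.of_bound ((measurable_siteGrad y hf).pow_const 2).aestronglyMeasurable ((C + C) ^ 2)
      (Eventually.of_forall fun σ => by
        rw [Real.norm_eq_abs, abs_pow]
        refine pow_le_pow_left₀ (abs_nonneg _) ?_ 2
        unfold siteGrad; exact (abs_sub _ _).trans (add_le_add (hC _) (hC _)))
  have hiDg : ∀ y : Site d, Integrable (fun σ => siteGrad y g σ ^ 2) μ := fun y =>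
    Integrable.of_bound ((measurable_siteGrad y hgm).pow_const 2).aestronglyMeasurable ((C + C) ^ 2)
      (Eventually.of_forall fun σ => by
        rw [Real.norm_eq_abs, abs_pow]
        refine pow_le_pow_left₀ (abs_nonneg _) ?_ 2
        unfold siteGrad; exact (abs_sub _ _).trans (add_le_add (hgb _) (hgb _)))
  have hsumD : ∀ S : Finset (Site d), ∫ σ, gradSq S f σ ∂μ = ∑ y ∈ S, D y := fun S => by
    unfold gradSq; exact integral_finsetSum _ fun y _ => hiDf y μ
  set I : Site d → ℝ := fun x => ∫ σ, siteGrad x g σ ^ 2 ∂μ with hI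
  have hLHS : ∫ σ, gradSq A g σ ∂μ = ∑ x ∈ A, I x := by
    unfold gradSq; exact integral_finsetSum _ fun x _ => hiDg x
  -- the three cases for `x`
  have hIB : ∀ x ∈ B, I x = 0 := by
    intro x hxB
    have h0 : ∀ σ, siteGrad x g σ = 0 := fun σ => by
      unfold siteGrad
      rw [sub_eq_zero]
      exact hgdep fun z hz => by
        rw [spinFlip_apply, if_neg]
        rintro rfl
        exact hz hxB
    show ∫ σ, siteGrad x g σ ^ 2 ∂μ = 0
    simp [h0]
  have hIfar : ∀ x ∈ A, x ∉ B → x ∉ O → I x ≤ D x := by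
    intro x hxA hxB hxO
    have hfar := h1 x hxA hxB hxO
    have hpt : ∀ σ, siteGrad x g σ ^ 2 ≤ bavg (U.spec β) B (fun ω => siteGrad x f ω ^ 2) σ := fun σ =>
      sq_sqrt_sub_sqrt_le_of_forall_lt U β hfar σ hf hC
    have hb : ∀ σ, |siteGrad x f σ ^ 2| ≤ (C + C) ^ 2 := fun σ => by
      rw [abs_pow]; refine pow_le_pow_left₀ (abs_nonneg _) ?_ 2
      unfold siteGrad; exact (abs_sub _ _).trans (add_le_add (hC _) (hC _))
    have hib : Integrable (bavg (U.spec β) B (fun ω => siteGrad x f ω ^ 2)) μ :=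
      Integrable.of_bound (measurable_bavg hγ B ((measurable_siteGrad x hf).pow_const 2)).aestronglyMeasurable
        ((C + C) ^ 2) (Eventually.of_forall fun σ => by
          rw [Real.norm_eq_abs]; exact abs_bavg_le hγ B hb σ)
    calc I x ≤ ∫ σ, bavg (U.spec β) B (fun ω => siteGrad x f ω ^ 2) σ ∂μ := integral_mono (hiDg x) hib hpt
      _ = D x := integral_integral_spec hγ hBV τ ((measurable_siteGrad x hf).pow_const 2) hb
  have hIO : ∀ x ∈ A, x ∉ B → x ∈ O → I x ≤ k * (D x + ∑ y ∈ B, e x y * D y) := by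
    intro x hxA hxB hxO
    set w : (Site d → ℤˣ) → ℝ := fun σ => siteGrad x f σ ^ 2 + ∑ y ∈ B, e x y * siteGrad y f σ ^ 2 with hw
    have he1 : ∀ y, e x y ≤ 1 := fun y =>
      Real.exp_le_one_iff.2 (neg_nonpos.2 (mul_nonneg hm'.le (Nat.cast_nonneg _)))
    have hwm : Measurable w := measurable_gradWeight x B (e x) hf
    have hwb : ∀ σ, |w σ| ≤ (1 + B.card) * (C + C) ^ 2 := fun σ => abs_gradWeight_le x B (he0 x) he1 hC σ
    have hpt : ∀ σ, siteGrad x g σ ^ 2 ≤ k * bavg (U.spec β) B w σ := by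
      intro σ
      haveI := hγ.isProbability B σ
      have ew : bavg (U.spec β) B w σ = ∫ ω, siteGrad x f ω ^ 2 ∂(U.spec β B σ) +
          ∑ y ∈ B, e x y * ∫ ω, siteGrad y f ω ^ 2 ∂(U.spec β B σ) :=
        integral_gradWeight_eq (U.spec β B σ) x B (e x) hf hC
      rw [ew]
      exact hGB σ x hxB f hf C hC
    have hib : Integrable (fun σ => k * bavg (U.spec β) B w σ) μ :=
      (Integrable.of_bound (measurable_bavg hγ B hwm).aestronglyMeasurable ((1 + B.card) * (C + C) ^ 2)
        (Eventually.of_forall fun σ => by rw [Real.norm_eq_abs]; exact abs_bavg_le hγ B hwb σ)).const_mul k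
    calc I x ≤ ∫ σ, k * bavg (U.spec β) B w σ ∂μ := integral_mono (hiDg x) hib hpt
      _ = k * ∫ σ, w σ ∂μ := by
          rw [integral_const_mul]
          congr 1
          exact integral_integral_spec hγ hBV τ hwm hwb
      _ = k * (D x + ∑ y ∈ B, e x y * D y) := by rw [integral_gradWeight_eq μ x B (e x) hf hC]
  -- summing over `x ∈ A`
  set A' := (A \ B).filter (· ∈ O) with hA'
  set A'' := (A \ B).filter (· ∉ O) with hA''
  have hA'O : A' ⊆ O := fun x hx => (Finset.mem_filter.1 hx).2
  have hsumA : ∑ x ∈ A, I x = ∑ x ∈ A', I x + ∑ x ∈ A'', I x := by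
    have h0 : ∑ x ∈ A \ (A \ B), I x = 0 :=
      Finset.sum_eq_zero fun x hx => by
        rw [Finset.mem_sdiff, Finset.mem_sdiff] at hx
        push Not at hx
        exact hIB x (hx.2 hx.1)
    rw [← Finset.sum_sdiff (Finset.sdiff_subset : A \ B ⊆ A), h0, zero_add]
    exact (Finset.sum_filter_add_sum_filter_not (A \ B) (· ∈ O) I).symm
  have hfar_sum : ∑ x ∈ A'', I x ≤ ∑ x ∈ A, D x := by
    calc ∑ x ∈ A'', I x ≤ ∑ x ∈ A'', D x := Finset.sum_le_sum fun x hx => by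
            obtain ⟨hx1, hx2⟩ := Finset.mem_filter.1 hx
            rw [Finset.mem_sdiff] at hx1
            exact hIfar x hx1.1 hx1.2 hx2
      _ ≤ ∑ x ∈ A, D x := Finset.sum_le_sum_of_subset_of_nonneg
            (fun x hx => (Finset.mem_sdiff.1 (Finset.mem_filter.1 hx).1).1) fun x _ _ => hD0 x
  have hO_sum : ∑ x ∈ A', I x ≤ k * ∑ x ∈ O, D x + k * ∑ y ∈ B, (∑ x ∈ A', e x y) * D y := by
    calc ∑ x ∈ A', I x ≤ ∑ x ∈ A', k * (D x + ∑ y ∈ B, e x y * D y) := Finset.sum_le_sum fun x hx => by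
            obtain ⟨hx1, hx2⟩ := Finset.mem_filter.1 hx
            rw [Finset.mem_sdiff] at hx1
            exact hIO x hx1.1 hx1.2 hx2
      _ = k * ∑ x ∈ A', D x + k * ∑ y ∈ B, (∑ x ∈ A', e x y) * D y := by
          rw [← Finset.mul_sum, Finset.sum_add_distrib, mul_add, Finset.sum_comm]
          congr 2
          exact Finset.sum_congr rfl fun y _ => by rw [Finset.sum_mul]
      _ ≤ k * ∑ x ∈ O, D x + k * ∑ y ∈ B, (∑ x ∈ A', e x y) * D y := by
          have : ∑ x ∈ A', D x ≤ ∑ x ∈ O, D x :=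
            Finset.sum_le_sum_of_subset_of_nonneg hA'O fun x _ _ => hD0 x
          nlinarith
  -- the lattice sums
  have hcoef : ∀ y ∈ B, ∑ x ∈ A', e x y ≤ K₁ * (if y ∈ O then 1 else 0) + K₂ * Real.exp (-(m' / 2 * w₀)) := by
    intro y hyB
    by_cases hyO : y ∈ O
    · rw [if_pos hyO, mul_one]
      have h1 : ∑ x ∈ A', e x y ≤ K₁ := by
        have := sum_exp_neg_mul_supDist_le_pow hm' hd y A'
        refine le_trans (le_of_eq (Finset.sum_congr rfl fun x _ => ?_)) this
        show Real.exp (-(m' * (supDist x y : ℝ))) = Real.exp (-(m' * (supDist y x : ℝ)))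
        rw [supDist_comm]
      have h2 : 0 ≤ K₂ * Real.exp (-(m' / 2 * w₀)) := by positivity
      linarith
    · rw [if_neg hyO, mul_zero, zero_add]
      have hfar : ∀ x ∈ A', (w₀ : ℝ) ≤ supDist x y := by
        intro x hx
        obtain ⟨hx1, hx2⟩ := Finset.mem_filter.1 hx
        rw [Finset.mem_sdiff] at hx1
        exact_mod_cast h2 y hyB hyO x hx1.1 hx1.2 hx2
      have hpt : ∀ x ∈ A', e x y ≤ Real.exp (-(m' / 2 * w₀)) * Real.exp (-(m' / 2 * (supDist y x : ℝ))) := by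
        intro x hx
        rw [he, ← Real.exp_add, supDist_comm y x]
        refine Real.exp_le_exp.2 ?_
        have := hfar x hx
        nlinarith
      calc ∑ x ∈ A', e x y ≤ ∑ x ∈ A', Real.exp (-(m' / 2 * w₀)) * Real.exp (-(m' / 2 * (supDist y x : ℝ))) :=
            Finset.sum_le_sum hpt
        _ = Real.exp (-(m' / 2 * w₀)) * ∑ x ∈ A', Real.exp (-(m' / 2 * (supDist y x : ℝ))) := by
            rw [Finset.mul_sum]
        _ ≤ Real.exp (-(m' / 2 * w₀)) * K₂ :=
            mul_le_mul_of_nonneg_left (sum_exp_neg_mul_supDist_le_pow (by positivity) hd y A') (Real.exp_nonneg _)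
        _ = K₂ * Real.exp (-(m' / 2 * w₀)) := mul_comm _ _
  have hdouble : ∑ y ∈ B, (∑ x ∈ A', e x y) * D y ≤
      K₁ * ∑ y ∈ O, D y + K₂ * Real.exp (-(m' / 2 * w₀)) * ∑ y ∈ B, D y := by
    calc ∑ y ∈ B, (∑ x ∈ A', e x y) * D y
        ≤ ∑ y ∈ B, (K₁ * (if y ∈ O then 1 else 0) + K₂ * Real.exp (-(m' / 2 * w₀))) * D y :=
          Finset.sum_le_sum fun y hy => mul_le_mul_of_nonneg_right (hcoef y hy) (hD0 y)
      _ = K₁ * ∑ y ∈ B, (if y ∈ O then 1 else 0) * D y + K₂ * Real.exp (-(m' / 2 * w₀)) * ∑ y ∈ B, D y := by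
          rw [Finset.mul_sum, Finset.mul_sum, ← Finset.sum_add_distrib]
          exact Finset.sum_congr rfl fun y _ => by ring
      _ ≤ K₁ * ∑ y ∈ O, D y + K₂ * Real.exp (-(m' / 2 * w₀)) * ∑ y ∈ B, D y := by
          have h1 : ∑ y ∈ B, (if y ∈ O then 1 else 0) * D y = ∑ y ∈ B.filter (· ∈ O), D y := by
            rw [Finset.sum_filter]
            exact Finset.sum_congr rfl fun y _ => by split_ifs <;> simp
          have h2 : ∑ y ∈ B.filter (· ∈ O), D y ≤ ∑ y ∈ O, D y :=
            Finset.sum_le_sum_of_subset_of_nonneg (fun y hy => (Finset.mem_filter.1 hy).2) fun y _ _ => hD0 y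
          rw [h1]
          nlinarith
  -- conclusion
  rw [hLHS, hsumA, hsumD A, hsumD O, hsumD B]
  have hsumO0 : 0 ≤ ∑ y ∈ O, D y := Finset.sum_nonneg fun y _ => hD0 y
  nlinarith [hfar_sum, hO_sum, hdouble, mul_nonneg hk hK₁0]

end Glauber

end Literature.Probability.LatticeModels

end
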